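import Literature.Geometry.Lorentzian.CoordConstraintAdjoint
import HarnessLib

/-!
# The formal adjoint of the linearised constraint map on a cut-off Killing initial datum:
# `DΦ*(0, ψX) = [DΦ*, ψ](0, X)` is first order in `dψ`

Everything here is PROVED; no definition and no statement of `Prop` type is introduced.

In the Corvino–Schoen / Chruściel–Delay gluing scheme the finite-dimensional cokernel of the
linearised constraint map `DΦ` on a domain `Ω` is detected by pairing `Φ` with CUT-OFF Killing
initial data `ψ·(N, X)`, `ψ ∈ C_c^∞(Ω)`: by the Green identity
(`MetricCoord.IsMetricOn.linConstraint_pairing_eq_sym`, `CoordConstraintAdjoint.lean`) and the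
divergence theorem, `∫ ψ ⟨DΦ(γ, κ), (N, X)⟩ = ∫ ⟨(γ, κ), DΦ*(ψN, ψX)⟩`, and for a KID `(N, X)`
the right-hand side only involves the commutator `[DΦ*, ψ]`, supported on `supp dψ`. This is how
Li–Mei 2020 (arXiv:2005.01249, proof of Prop. 4.1, p. 23, `(I_α)`) reduce the projections
`𝓘_α` onto `ker DΦ* = span{(0, ∂_t), (0, Ω_i)}` to boundary-layer integrals. This file records
the pointwise Leibniz rules behind it for the TANGENTIAL case `N = 0` of the symmetrised adjoint
(`adjMomGS`, `adjMomKS`):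

* `adjMomKS_smul` — `DM*ˢ_κ(ψX) = ψ DM*ˢ_κ(X) − sym(dψ ⊗ G(X,·)) + dψ(X) G`;
* `adjMomGS_smul` — `DM*ˢ_γ(ψX) = ψ DM*ˢ_γ(X) + sym(dψ ⊗ K(X,·)) − ½ dψ((K(X,·))^♯) G − ½ dψ(X) K`;
* `adjMomKS_smul_of_kid`, `adjMomGS_smul_of_kid` — for a tangential KID `X`
  (`DM*ˢ_γ X = 0 = DM*ˢ_κ X` at `x`) only the commutator terms remain;
* `pairAt_adjMomKS_smul_of_kid`, `pairAt_adjMomGS_smul_of_kid` — paired with symmetric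
  variations `(γ, κ)`: `⟨κ, DM*ˢ_κ(ψX)⟩ = −dψ(v_κ) + dψ(X) tr_G κ` with `v_κ = (κ(X,·))^♯`, i.e.
  `⟨κ, sym(dψ ⊗ G(X,·))⟩ = κ(X, ∇ψ)`, and
  `⟨γ, DM*ˢ_γ(ψX)⟩ = ⟨γ, dψ ⊗ K(X,·)⟩ − ½ dψ((K(X,·))^♯) tr_G γ − ½ dψ(X) ⟨γ, K⟩`.

## References

* J. Li, H. Mei, Comm. Math. Phys. 378 (2020), arXiv:2005.01249, §4, p. 23. [LiMei2020]
* J. Corvino, R. Schoen, J. Differential Geom. 73 (2006), §2–§3. [CorvinoSchoen2006]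
* P. T. Chruściel, E. Delay, Mém. SMF 94 (2003), §2–§3. [ChruscielDelay2003]
-/

noncomputable section

set_option maxSynthPendingDepth 3

open Set Filter ContinuousLinearMap Module
open scoped Topology ContDiff

namespace Literature.Geometry.Lorentzian

namespace MetricCoord

variable {E : Type*} [NormedAddCommGroup E] [NormedSpace ℝ E] [FiniteDimensional ℝ E]
  {G K : E → E →L[ℝ] E →L[ℝ] ℝ} {V : Set E} {x : E} {ψ : E → ℝ} {X : E → E}

omit [FiniteDimensional ℝ E] in
/-- `sym` is additive. [folklore] -/
theorem symAt_add (B C : E →L[ℝ] E →L[ℝ] ℝ) : symAt (B + C) = symAt B + symAt C := by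
  ext v w; simp only [symAt_apply, _root_.add_apply]; ring

omit [FiniteDimensional ℝ E] in
/-- `sym` is homogeneous. [folklore] -/
theorem symAt_smul (c : ℝ) (B : E →L[ℝ] E →L[ℝ] ℝ) : symAt (c • B) = c • symAt B := by
  ext v w; simp only [symAt_apply, _root_.smul_apply, smul_eq_mul]; ring

omit [FiniteDimensional ℝ E] in
/-- `T ∘ (dψ ⊗ z) = dψ ⊗ T(z)` for a bilinear form `T`. [folklore] -/
theorem comp_smulRight (T : E →L[ℝ] E →L[ℝ] ℝ) (φ : E →L[ℝ] ℝ) (z : E) :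
    T.comp (φ.smulRight z) = φ.smulRight (T z) := by
  ext v w
  simp only [ContinuousLinearMap.comp_apply, ContinuousLinearMap.smulRight_apply, map_smul,
    _root_.smul_apply]

/-- **Leibniz rule for the `κ`-row of the symmetrised adjoint**:
`DM*ˢ_κ(ψX)|_x = ψ(x) DM*ˢ_κ(X)|_x − sym(dψ_x ⊗ G_x(X x, ·)) + dψ_x(X x) G_x`
(`∇(ψX) = ψ∇X + dψ ⊗ X`, `div(ψX) = ψ div X + dψ(X)`). [cite: LiMei2020, proof of Prop. 4.1, p. 23] -/
theorem adjMomKS_smul (hψ : DifferentiableAt ℝ ψ x) (hX : DifferentiableAt ℝ X x) :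
    adjMomKS G (fun y ↦ ψ y • X y) x =
      ψ x • adjMomKS G X x - symAt ((fderiv ℝ ψ x).smulRight (G x (X x)))
        + (fderiv ℝ ψ x (X x)) • G x := by
  rw [adjMomKS, adjMomKS, covDAt_smul hψ hX, divAt_smul hψ hX, ContinuousLinearMap.comp_add,
    ContinuousLinearMap.comp_smul, comp_smulRight, symAt_add, symAt_smul, add_smul, smul_add,
    smul_neg, smul_smul]
  abel

omit [FiniteDimensional ℝ E] in
/-- Index raising commutes with scalar multiplication inside: `♯(K(ψX, ·)) = ψ ♯(K(X,·))`.
[folklore] -/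
theorem sharpAt_apply_smul (y : E) :
    sharpAt G y (K y (ψ y • X y)) = ψ y • sharpAt G y (K y (X y)) := by
  rw [map_smul, map_smul]

/-- **Leibniz rule for the `γ`-row of the symmetrised adjoint**:
`DM*ˢ_γ(ψX)|_x = ψ(x) DM*ˢ_γ(X)|_x + sym(dψ_x ⊗ K_x(X x,·)) − ½ dψ_x(♯K_x(X x,·)) G_x − ½ dψ_x(X x) K_x`
(`∇_{ψX}K = ψ∇_X K` is tensorial; `div(ψ Y) = ψ div Y + dψ(Y)` for `Y = (K(X,·))^♯`).
[cite: LiMei2020, proof of Prop. 4.1, p. 23] -/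
theorem adjMomGS_smul (hψ : DifferentiableAt ℝ ψ x) (hX : DifferentiableAt ℝ X x)
    (hKX : DifferentiableAt ℝ (fun y ↦ sharpAt G y (K y (X y))) x) :
    adjMomGS G K (fun y ↦ ψ y • X y) x =
      ψ x • adjMomGS G K X x + symAt ((fderiv ℝ ψ x).smulRight (K x (X x)))
        - (2⁻¹ * fderiv ℝ ψ x (sharpAt G x (K x (X x)))) • G x
        - (2⁻¹ * fderiv ℝ ψ x (X x)) • K x := by
  have hfun : (fun y ↦ sharpAt G y (K y (ψ y • X y))) = fun y ↦ ψ y • sharpAt G y (K y (X y)) :=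
    funext fun y ↦ sharpAt_apply_smul y
  rw [adjMomGS, adjMomGS, covDAt_smul hψ hX, divAt_smul hψ hX, hfun, divAt_smul hψ hKX,
    ContinuousLinearMap.comp_add, ContinuousLinearMap.comp_smul, comp_smulRight, symAt_add,
    symAt_smul, map_smul]
  ext v w
  simp only [_root_.add_apply, _root_.sub_apply, _root_.smul_apply, smul_eq_mul]
  ring

/-- For a **tangential KID** `X` at `x` (`DM*ˢ_κ X = 0`), `DM*ˢ_κ(ψX)` is the commutator
`−sym(dψ ⊗ G(X,·)) + dψ(X) G`, first order in `dψ` and independent of the derivatives of `X`.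
[cite: LiMei2020, proof of Prop. 4.1, p. 23] -/
theorem adjMomKS_smul_of_kid (hψ : DifferentiableAt ℝ ψ x) (hX : DifferentiableAt ℝ X x)
    (hkid : adjMomKS G X x = 0) :
    adjMomKS G (fun y ↦ ψ y • X y) x =
      -symAt ((fderiv ℝ ψ x).smulRight (G x (X x))) + (fderiv ℝ ψ x (X x)) • G x := by
  rw [adjMomKS_smul hψ hX, hkid, smul_zero, zero_sub]

/-- For a **tangential KID** `X` at `x` (`DM*ˢ_γ X = 0`), `DM*ˢ_γ(ψX)` is the commutator
`sym(dψ ⊗ K(X,·)) − ½ dψ(♯K(X,·)) G − ½ dψ(X) K`. [cite: LiMei2020, proof of Prop. 4.1, p. 23] -/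
theorem adjMomGS_smul_of_kid (hψ : DifferentiableAt ℝ ψ x) (hX : DifferentiableAt ℝ X x)
    (hKX : DifferentiableAt ℝ (fun y ↦ sharpAt G y (K y (X y))) x) (hkid : adjMomGS G K X x = 0) :
    adjMomGS G K (fun y ↦ ψ y • X y) x =
      symAt ((fderiv ℝ ψ x).smulRight (K x (X x)))
        - (2⁻¹ * fderiv ℝ ψ x (sharpAt G x (K x (X x)))) • G x
        - (2⁻¹ * fderiv ℝ ψ x (X x)) • K x := by
  rw [adjMomGS_smul hψ hX hKX, hkid, smul_zero, zero_add]

/-! ### The pairings with symmetric variations -/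

section Pairing

variable {ι : Type*} [Fintype ι] (b : Basis ι ℝ E)

omit [Fintype ι] in
/-- **The pairing of the metric with a tensor product of covectors**: `⟨G, φ ⊗ θ⟩_G = φ(♯θ)`
(`= g^{kl} φ_k θ_l`; the trace of `φ ⊗ ♯θ`). [cite: ONeill1983, Ch. 3, pp. 60–61] -/
theorem pairAt_metric_smulRight (hi : (G x).IsInvertible) (φ θ : E →L[ℝ] ℝ) :
    pairAt G x (G x) (φ.smulRight θ) = φ (sharpAt G x θ) := by
  rw [pairAt_comm, pairAt_metric_right hi, mtrAt_eq_traceCLM, traceCLM_apply]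
  have h : ((sharpAt G x).comp (φ.smulRight θ) : E →L[ℝ] E) = φ.smulRight (sharpAt G x θ) := by
    ext v
    simp only [ContinuousLinearMap.comp_apply, ContinuousLinearMap.smulRight_apply, map_smul]
  rw [h]
  have h2 : ((φ.smulRight (sharpAt G x θ) : E →L[ℝ] E) : E →ₗ[ℝ] E) =
      ((φ : E →L[ℝ] ℝ) : E →ₗ[ℝ] ℝ).smulRight (sharpAt G x θ) := LinearMap.ext fun v ↦ rfl
  rw [h2, LinearMap.trace_smulRight]
  rfl

omit [Fintype ι] in
/-- **The pairing with a tensor product of covectors**: `⟨α, φ ⊗ θ⟩_G = α(♯θ, ♯φ)`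
(`= g^{ik} g^{jl} α_{ij} φ_k θ_l`), for symmetric `G_x`. [cite: ONeill1983, Ch. 3, pp. 60–61] -/
theorem pairAt_smulRight_right (hi : (G x).IsInvertible) (hGs : ∀ v w, G x v w = G x w v)
    (α : E →L[ℝ] E →L[ℝ] ℝ) (φ θ : E →L[ℝ] ℝ) :
    pairAt G x α (φ.smulRight θ) = α (sharpAt G x θ) (sharpAt G x φ) := by
  rw [pairAt_apply, traceCLM_apply]
  have h : (((sharpAt G x).comp α).comp ((sharpAt G x).comp (φ.smulRight θ)) : E →L[ℝ] E) =
      φ.smulRight (sharpAt G x (α (sharpAt G x θ))) := by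
    ext v
    simp only [ContinuousLinearMap.comp_apply, ContinuousLinearMap.smulRight_apply, map_smul]
  rw [h]
  have h2 : ((φ.smulRight (sharpAt G x (α (sharpAt G x θ))) : E →L[ℝ] E) : E →ₗ[ℝ] E) =
      ((φ : E →L[ℝ] ℝ) : E →ₗ[ℝ] ℝ).smulRight (sharpAt G x (α (sharpAt G x θ))) :=
    LinearMap.ext fun v ↦ rfl
  rw [h2, LinearMap.trace_smulRight]
  -- `φ(♯ω) = ω(♯φ)` for `ω = α(♯θ)`
  change φ (sharpAt G x (α (sharpAt G x θ))) = α (sharpAt G x θ) (sharpAt G x φ)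
  rw [← apply_sharpAt_apply hi φ (sharpAt G x (α (sharpAt G x θ))), hGs,
    apply_sharpAt_apply hi]

/-- **`⟨κ, DM*ˢ_κ(ψX)⟩` for a tangential KID**: for symmetric `κ_x` and `G_x`,
`⟨κ, DM*ˢ_κ(ψX)⟩_G = −κ(♯G(X,·), ♯dψ) + dψ(X) tr_G κ = −κ(X, ∇ψ) + dψ(X) tr_G κ`.
[cite: LiMei2020, proof of Prop. 4.1, p. 23] -/
theorem IsMetricOn.pairAt_adjMomKS_smul_of_kid (hG : IsMetricOn G V) (hx : x ∈ V)
    (hψ : DifferentiableAt ℝ ψ x) (hX : DifferentiableAt ℝ X x) (hkid : adjMomKS G X x = 0)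
    {κx : E →L[ℝ] E →L[ℝ] ℝ} (hκs : ∀ v w, κx v w = κx w v) :
    pairAt G x κx (adjMomKS G (fun y ↦ ψ y • X y) x) =
      -κx (X x) (sharpAt G x (fderiv ℝ ψ x)) + fderiv ℝ ψ x (X x) * mtrAt G x κx := by
  have hi := hG.isInvertible x hx
  have hGs := hG.symm x hx
  rw [adjMomKS_smul_of_kid hψ hX hkid, pairAt_add_right, pairAt_neg_right,
    pairAt_symAt_right hi hGs hκs, pairAt_smulRight_right hi hGs, sharpAt_apply hi,
    pairAt_smul_right, pairAt_metric_right hi]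

/-- **`⟨γ, DM*ˢ_γ(ψX)⟩` for a tangential KID**: for symmetric `γ_x` and `G_x`,
`⟨γ, DM*ˢ_γ(ψX)⟩_G = γ(♯K(X,·), ∇ψ) − ½ dψ(♯K(X,·)) tr_G γ − ½ dψ(X) ⟨γ, K⟩_G`.
[cite: LiMei2020, proof of Prop. 4.1, p. 23] -/
theorem IsMetricOn.pairAt_adjMomGS_smul_of_kid (hG : IsMetricOn G V) (hx : x ∈ V)
    (hψ : DifferentiableAt ℝ ψ x) (hX : DifferentiableAt ℝ X x)
    (hKX : DifferentiableAt ℝ (fun y ↦ sharpAt G y (K y (X y))) x) (hkid : adjMomGS G K X x = 0)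
    {γx : E →L[ℝ] E →L[ℝ] ℝ} (hγs : ∀ v w, γx v w = γx w v) :
    pairAt G x γx (adjMomGS G K (fun y ↦ ψ y • X y) x) =
      γx (sharpAt G x (K x (X x))) (sharpAt G x (fderiv ℝ ψ x))
        - 2⁻¹ * fderiv ℝ ψ x (sharpAt G x (K x (X x))) * mtrAt G x γx
        - 2⁻¹ * fderiv ℝ ψ x (X x) * pairAt G x γx (K x) := by
  have hi := hG.isInvertible x hx
  have hGs := hG.symm x hx
  rw [adjMomGS_smul_of_kid hψ hX hKX hkid, pairAt_sub_right, pairAt_sub_right,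
    pairAt_symAt_right hi hGs hγs, pairAt_smulRight_right hi hGs, pairAt_smul_right,
    pairAt_smul_right, pairAt_metric_right hi]

end Pairing

end MetricCoord

end Literature.Geometry.Lorentzian

end
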